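import Summits.HubbardSuperconductivity.HubbardSuperconductivity.Theorems.BalabanIRBirComplexStableXYRHessianOrigin
import Summits.HubbardSuperconductivity.HubbardSuperconductivity.Theorems.BalabanIRBirComplexStableXYRStubThinFormCoercive
import HarnessLib

/-!
# Route `BalabanIR`, crux `BirComplexStableXYR` (item `stmt-HubbardSuperconductivity-14845`),
# line `fat-gaussian-defect-calculus`: stub A1 (S) `stub_spatialHolonomyFormCoercive`

Helper (`--supports`) for the crux
`Summit.HubbardSuperconductivity.HubbardSuperconductivity.Theses.BalabanIR.BirComplexStableXYR`,
line `fat-gaussian-defect-calculus` (lead skeleton `Cruxes/BirComplexStableXYR/Lines/fat_gaussian_defect_calculus.lean`,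
lead c8, wave 9), stub A1 (S) `stub_spatialHolonomyFormCoercive`: **coercivity of the spatial holonomy form.**

**Statement.** For a window Fourier table `c : Table r` (`r ≥ 2`, window `W r = Fin r × Fin r × Fin r`, vocabulary of
`Theorems.BirComplexStableXY.Negative.WitnessTable`) with (N) `Σ_n c_n = 0` and the coercivity (C)
`c₀ ΣΣ (1 − cos(φ_w − φ_w')) ≤ Re F(φ)`, let `Q` be the real window Hessian form at the constants,
`Q(u) = Re(−Σ_n c_n (n·u)²)` (defining hypothesis `hQ`).  Then for all real `x, y` the spatially linear window
configuration `v_w = x·w₁ + y·w₂` satisfies `c₀ (x² + y²) ≤ Q(v)`.  (The Gaussian weight of the spatial holonomy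
sector `(h₀, h₁)` is `exp(−(K/2)|Λ| Q(v))` with `x = 2πh₀/L`, `y = 2πh₁/L`; this coercivity makes the spatial theta
series summable.)

**Proof.** The configuration `v` vanishes at the corner `(0,0,0)` of the window and takes the values `x`, `y`, `0` at
the unit vectors `(1,0,0)`, `(0,1,0)`, `(0,0,1)` (these exist since `r ≥ 2`).  The landed window-level consequence of
the second-order condition `Theorems.cvxr_re_hess_origin_ge` for such four values,
`FSUnfolding.thinForm_hess_ge_of_values` (file `…StubThinFormCoercive`), gives `2c₀ (x² + y² + 0²) ≤ Q(v)`, and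
`c₀ (x² + y²) ≤ 2c₀ (x² + y²)` because `c₀ > 0`.  Elementary; no definition and no named fact is introduced;
sorry-free. [folklore]
-/

set_option linter.dupNamespace false -- `Summit.<S>.<S>.Theorems…` repeats the summit name (D-0017 layout)

namespace Summit.HubbardSuperconductivity.HubbardSuperconductivity.Theorems.FSUnfolding

open scoped BigOperators
open Literature.MathematicalPhysics.QuantumFieldTheory Literature.Probability.LatticeModels
open Summit.HubbardSuperconductivity.BirComplexStableXYNegative

/-- **Stub A1 (S) `stub_spatialHolonomyFormCoercive` (registered signature, verbatim): coercivity of the spatial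
holonomy form.**  Under (N), (C) and `r ≥ 2` the window Hessian form `Q(u) = Re(−Σ_n c_n (n·u)²)` of the spatially
linear configuration `w ↦ x·w₁ + y·w₂` dominates `c₀ (x² + y²)`: that configuration is `0` at the corner `(0,0,0)` and
`x`, `y`, `0` at the three unit vectors, so the four-value form of the second-order condition
(`thinForm_hess_ge_of_values`, from `cvxr_re_hess_origin_ge`) bounds `Q` below by `2c₀ (x² + y²) ≥ c₀ (x² + y²)`.
[folklore] -/
theorem stub_spatialHolonomyFormCoercive :
    ∀ (r : ℕ) (c : Table r) (c₀ : ℝ), 2 ≤ r → 0 < c₀ → c.sum (fun _ a => a) = 0 →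
      (∀ φ : W r → ℝ, c₀ * ∑ w, ∑ w', (1 - Real.cos (φ w - φ w')) ≤ (genF c φ).re) →
      ∀ (Q : (W r → ℝ) → ℝ),
      (∀ u : W r → ℝ, Q u = (-c.sum (fun n a => a * (((∑ w, (n w : ℝ) * u w) ^ 2 : ℝ) : ℂ))).re) →
      ∀ (x y : ℝ), c₀ * (x ^ 2 + y ^ 2) ≤ Q (fun w => x * ((w.1 : ℕ) : ℝ) + y * ((w.2.1 : ℕ) : ℝ)) := by
  intro r c c₀ hr hc₀ hN hC Q hQ x y
  have hH := thinForm_hess_ge_of_values c hr hc₀ hN hC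
    (fun w => x * ((w.1 : ℕ) : ℝ) + y * ((w.2.1 : ℕ) : ℝ)) x y 0
    (by simp) (by simp) (by simp) (by simp)
  rw [hQ]
  have hxy : 0 ≤ c₀ * (x ^ 2 + y ^ 2) := mul_nonneg hc₀.le (by positivity)
  linarith

end Summit.HubbardSuperconductivity.HubbardSuperconductivity.Theorems.FSUnfolding
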